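/-
Copyright (c) 2026 the pub-hodgecm-mathlib formalisation cell (harness21).  Prover seat hodgecm-mathlib-LH4-p07 (g3), req620 Track A «(D-RAM) FOUR-FRAME» squad
(MS ROAD A, Stage B brick B7 (iv) «CORE-HANGING COUNT», FILE (B); Stage B lead LH4-p10 (g2), dealer LH4-plan (g11)).  2026-09-04.
-/
import Literature.NumberTheory.LocalFields.RamifiedQuadraticResidueCountsUnits   -- ★ p855694 B1 (F0P3-p01): (C4) `relIndex_fixedUnitLevel_eq` (`[U_F : U_{F,n}] = (q−1)q^{⌈n∕2⌉−1}`)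
import Mathlib.GroupTheory.QuotientGroup.Basic
import HarnessLib

/-!
# Crux `H413`, MS ROAD A, STAGE B brick B7 (iv), FILE (B): the ADMISSIBLE `F`-rational classes of the core-hanging invariant `κ` — among a complete irredundant system `R` of
# `σ`-fixed units modulo `𝔭^ρ` (`#R = (q−1)·q^{⌈ρ∕2⌉−1}`), exactly `q^{⌈ρ∕2⌉−1}` are `≡ −1 (𝔭)`, so `#{g ∈ R : |1 + g| = 1} = (q − 2)·q^{⌈ρ∕2⌉−1}`

Cell `hodgecm-mathlib` (D-0151), FLOOR 0, crux item H413 = `stmt-HodgeConjecture-24833`; lane `--supports stmt-HodgeConjecture-24833 --as helper` (count-neutral).  THEOREMS ONLY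
(no `def`, no instance, no notation, no `sorry`, default heartbeats).  LH4-p10 (g2) MEMO v2 §4 (H): on the core-hanging stratum `H(2ρ)` the class of `κ = y″∕(xζ)` modulo `𝔭^ρ`
is `F`-rational (dualisability, ★ B7 (i) ∕ FILE (A)) AND `κ ≢ −1 (𝔭)` (`|xζ + y″| = 1`); this file counts those classes.  CURRENCY-FREE in the representative system: `R` is
ANY finite set of `σ`-fixed units, complete and irredundant modulo `𝔭^ρ`, of the B1 cardinality — e.g. ★ (iv-c) `exists_fixed_class_representatives … ρ 0` (LH4-p08 (g2)) — so
this file imports only ★ B1.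

THE MATHEMATICS.  `U_F ⊇ U_{F,1} ⊇ U_{F,ρ}` the `σ`-fixed units and their levels (membership letters as in ★ B1; built inline, no `def`).  The «bad» representatives
`R_bad = {g ∈ R : |1 + g| < 1}` are in bijection with `U_{F,1} ∕ U_{F,ρ}` via `g ↦ [−g]` (injective by irredundancy, surjective by completeness: the representative of `−u` is bad),
so `#R_bad = [U_{F,1} : U_{F,ρ}]`, and `[U_F : U_{F,ρ}] = [U_F : U_{F,1}]·[U_{F,1} : U_{F,ρ}]` with ★ B1 at `n = ρ` and `n = 1` (`[U_F : U_{F,1}] = q − 1`) gives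
`#R_bad = q^{⌈ρ∕2⌉−1}`; hence `#{g ∈ R : |1 + g| = 1} = #R − #R_bad = (q − 2)·q^{⌈ρ∕2⌉−1}`.
* §1 `v_one_add_le_one`.
* §2 **`ncard_bad_representatives_eq`** (`= q^{(ρ+1)∕2−1}`), **`ncard_admissible_representatives_eq`** (`= (q − 2)·q^{(ρ+1)∕2−1}`).
HONEST LABEL.  Count-neutral; `HC_CM` is proved only modulo the 7 printed citations (2 remaining named inputs: hLiu418 = `stmt-HodgeConjecture-24832`, h413 = `stmt-HodgeConjecture-24833`)
until rung 0 closes.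

## References
* [Serre1979] J.-P. Serre, *Local Fields*, GTM 67 (1979), Ch. IV §2 Prop. 6 (`U∕U¹ ≅ 𝓀^×`, `Uⁱ∕Uⁱ⁺¹ ≅ 𝓀`), Ch. II §2 Prop. 3, Cor. 2–3 pp. 28–29.
* [Kottwitz1986BaseChangeUnits] R. Kottwitz, *Base change for unit elements of Hecke algebras*, Compositio Math. 60 (1986), §1 pp. 240–241 (lattice counts via torus orbits).
-/

set_option autoImplicit false

noncomputable section

namespace Summit.HodgeConjecture.HodgeConjecture.Cruxes.H413.F0P3cDyRamDiagonalCoreHangingClasses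

open WithZero Subgroup
open Literature.NumberTheory.LocalFields.WildQuadraticDatum
open scoped Valued

variable {K : Type*} [Field K] [Valued K ℤᵐ⁰]

/-! ## §1 Small valuation facts -/

/-- `|1 + g| ≤ 1` for a unit `g`. [cite: Serre1979, Ch. II §2 Prop. 3, Cor. 2–3 pp. 28–29] -/
theorem v_one_add_le_one {g : K} (hg : Valued.v g = 1) : Valued.v (1 + g) ≤ 1 :=
  (Valuation.map_add _ _ _).trans (max_le (by rw [map_one]) hg.le)

/-! ## §2 Counting the bad and the admissible representatives -/

/-- **THE REPRESENTATIVES `≡ −1 (𝔭)` NUMBER `q^{⌈ρ∕2⌉−1}`.**  For the ramified quadratic datum letters `hσ hvσ hfix hϖ hd`, a finite residue field (`q = #𝓀`), `ρ ≥ 1`, and a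
system `R` of `σ`-fixed units complete and irredundant modulo `𝔭^ρ` with `#R = (q − 1)·q^{⌈ρ∕2⌉−1}`: `#{g ∈ R : |1 + g| < 1} = q^{⌈ρ∕2⌉−1}` (`= [U_{F,1} : U_{F,ρ}]`, ★ B1 twice).
[cite: Serre1979, Ch. IV §2 Prop. 6] [cite: Kottwitz1986BaseChangeUnits, §1 pp. 240–241] -/
theorem ncard_bad_representatives_eq {σ : K →+* K} {ϖ : K} {d : ℕ} (hσ : ∀ x, σ (σ x) = x) (hvσ : ∀ a, Valued.v (σ a) = Valued.v a)
    (hfix : ∀ x : K, σ x = x → x ≠ 0 → ∃ n : ℤ, Valued.v x = exp (2 * n)) (hϖ : Valued.v ϖ = exp (-1 : ℤ))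
    (hd : Valued.v (ϖ - σ ϖ) = Valued.v ϖ ^ d) [Finite 𝓀[K]] {ρ : ℕ} (hρ : 1 ≤ ρ) {R : Set K} (hRfin : R.Finite)
    (hR1 : ∀ g ∈ R, σ g = g ∧ Valued.v g = 1) (hR2 : ∀ f : K, σ f = f → Valued.v f = 1 → ∃ g ∈ R, Valued.v (f - g) ≤ Valued.v ϖ ^ ρ)
    (hR3 : ∀ g ∈ R, ∀ g' ∈ R, Valued.v (g - g') ≤ Valued.v ϖ ^ ρ → g = g') :
    {g ∈ R | Valued.v (1 + g) < 1}.ncard = Nat.card 𝓀[K] ^ ((ρ + 1) / 2 - 1) := by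
  classical
  have hϖρ : Valued.v ϖ ^ ρ = exp (-(ρ : ℤ)) := by rw [hϖ, ← exp_nsmul, nsmul_eq_mul, mul_neg, mul_one]
  have hϖρ1 : Valued.v ϖ ^ ρ < 1 := by rw [hϖρ, ← exp_zero, exp_lt_exp]; omega
  -- the fixed units `U`, the level-`1` and level-`ρ` subgroups
  let U : Subgroup Kˣ :=
    { carrier := {u | σ (u : K) = u ∧ Valued.v (u : K) = 1}
      mul_mem' := fun {a b} ha hb => ⟨by rw [Units.val_mul, map_mul, ha.1, hb.1], by rw [Units.val_mul, map_mul, ha.2, hb.2, mul_one]⟩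
      one_mem' := ⟨by rw [Units.val_one, map_one], by rw [Units.val_one, map_one]⟩
      inv_mem' := fun {a} ha => ⟨by rw [Units.val_inv_eq_inv_val, map_inv₀, ha.1], by rw [Units.val_inv_eq_inv_val, map_inv₀, ha.2, inv_one]⟩ }
  have hU : ∀ u : Kˣ, u ∈ U ↔ σ u = u ∧ Valued.v (u : K) = 1 := fun u => Iff.rfl
  have mkLevel : ∀ n : ℕ, ∃ Un : Subgroup Kˣ, ∀ u : Kˣ, u ∈ Un ↔ (σ u = u ∧ Valued.v (u : K) = 1) ∧ Valued.v ((u : K) - 1) ≤ exp (-(n : ℤ)) := fun n =>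
    ⟨{ carrier := {u | (σ (u : K) = u ∧ Valued.v (u : K) = 1) ∧ Valued.v ((u : K) - 1) ≤ exp (-(n : ℤ))}
       mul_mem' := fun {a b} ha hb => by
         refine ⟨⟨by rw [Units.val_mul, map_mul, ha.1.1, hb.1.1], by rw [Units.val_mul, map_mul, ha.1.2, hb.1.2, mul_one]⟩, ?_⟩
         have h : (a : K) * b - 1 = a * ((b : K) - 1) + ((a : K) - 1) := by ring
         rw [Units.val_mul, h]
         refine Valuation.map_add_le _ ?_ ha.2
         rw [map_mul, ha.1.2, one_mul]; exact hb.2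
       one_mem' := ⟨⟨by rw [Units.val_one, map_one], by rw [Units.val_one, map_one]⟩, by rw [Units.val_one, sub_self, map_zero]; exact zero_le⟩
       inv_mem' := fun {a} ha => by
         refine ⟨⟨by rw [Units.val_inv_eq_inv_val, map_inv₀, ha.1.1], by rw [Units.val_inv_eq_inv_val, map_inv₀, ha.1.2, inv_one]⟩, ?_⟩
         have h : ((a⁻¹ : Kˣ) : K) - 1 = (a⁻¹ : Kˣ) * (1 - (a : K)) := by
           rw [mul_sub, mul_one, ← Units.val_mul, inv_mul_cancel, Units.val_one]
         rw [h, map_mul, Units.val_inv_eq_inv_val, map_inv₀, ha.1.2, inv_one, one_mul, Valuation.map_sub_swap]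
         exact ha.2 }, fun _ => Iff.rfl⟩
  obtain ⟨U₁, hU₁⟩ := mkLevel 1
  obtain ⟨Uρ, hUρ⟩ := mkLevel ρ
  have hle₁ : U₁ ≤ U := fun u hu => ((hU₁ u).1 hu).1
  have hleρ : Uρ ≤ U₁ := fun u hu => by
    rw [hU₁]; rw [hUρ] at hu
    exact ⟨hu.1, hu.2.trans (exp_le_exp.2 (by push_cast; omega))⟩
  -- the indices (★ B1 twice, and the tower)
  have hidxρ : Uρ.relIndex U = (Nat.card 𝓀[K] - 1) * Nat.card 𝓀[K] ^ ((ρ + 1) / 2 - 1) := relIndex_fixedUnitLevel_eq hσ hvσ hfix hϖ hd hU hρ hUρ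
  have hidx₁ : U₁.relIndex U = Nat.card 𝓀[K] - 1 := by
    rw [relIndex_fixedUnitLevel_eq hσ hvσ hfix hϖ hd hU le_rfl (by exact_mod_cast hU₁)]
    simp
  have hq : 1 < Nat.card 𝓀[K] := Finite.one_lt_card
  have hB : Uρ.relIndex U₁ = Nat.card 𝓀[K] ^ ((ρ + 1) / 2 - 1) := by
    have h := Subgroup.relIndex_mul_relIndex Uρ U₁ U hleρ hle₁
    rw [hidxρ, hidx₁, mul_comm] at h
    exact mul_left_cancel₀ (by omega) h
  -- the bijection `R_bad → U₁ ⧸ Uρ`, `g ↦ [−g]`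
  set Rbad : Set K := {g ∈ R | Valued.v (1 + g) < 1} with hRbad
  have hbadU₁ : ∀ g ∈ Rbad, ∃ hg0 : -g ≠ 0, Units.mk0 (-g) hg0 ∈ U₁ := by
    rintro g ⟨hgR, hg⟩
    obtain ⟨hσg, hvg⟩ := hR1 g hgR
    have hg0 : -g ≠ 0 := neg_ne_zero.2 fun h0 => by rw [h0, map_zero] at hvg; exact zero_ne_one hvg
    refine ⟨hg0, (hU₁ _).2 ⟨⟨by rw [Units.val_mk0, map_neg, hσg], by rw [Units.val_mk0, Valuation.map_neg, hvg]⟩, ?_⟩⟩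
    rw [Units.val_mk0, show -g - 1 = -(1 + g) by ring, Valuation.map_neg]
    -- discreteness of `ℤᵐ⁰`: `|1 + g| < 1 ⇒ |1 + g| ≤ exp(−1)`
    rcases eq_or_ne (Valued.v (1 + g)) 0 with h0 | h0
    · rw [h0]; exact zero_le
    · rw [← exp_log h0, exp_le_exp]
      rw [← exp_log h0, ← exp_zero, exp_lt_exp] at hg
      push_cast
      omega
  let toU₁ : Rbad → U₁ := fun g => ⟨Units.mk0 (-(g : K)) (hbadU₁ g g.2).choose, (hbadU₁ g g.2).choose_spec⟩
  have htoU₁ : ∀ g : Rbad, ((toU₁ g : Kˣ) : K) = -(g : K) := fun _ => rfl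
  have hcoe : ∀ (g : Rbad) (u : U₁), ((((toU₁ g)⁻¹ * u : U₁) : Kˣ) : K) = (-(g : K))⁻¹ * ((u : Kˣ) : K) := fun g u => by
    rw [Subgroup.coe_mul, Subgroup.coe_inv, Units.val_mul, Units.val_inv_eq_inv_val, htoU₁]
  let ψ : Rbad → U₁ ⧸ Uρ.subgroupOf U₁ := fun g => QuotientGroup.mk (toU₁ g)
  have hψ : Function.Bijective ψ := by
    constructor
    · intro g g' h
      apply Subtype.ext
      change (QuotientGroup.mk (toU₁ g) : U₁ ⧸ Uρ.subgroupOf U₁) = QuotientGroup.mk (toU₁ g') at h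
      rw [QuotientGroup.eq, Subgroup.mem_subgroupOf, hUρ, hcoe, htoU₁] at h
      obtain ⟨-, h⟩ := h
      have hvg : Valued.v (g : K) = 1 := (hR1 g g.2.1).2
      have hg0 : (g : K) ≠ 0 := fun h0 => by rw [h0, map_zero] at hvg; exact zero_ne_one hvg
      have e : (-(g : K))⁻¹ * -(g' : K) - 1 = ((g' : K) - g) / g := by field_simp
      rw [e, map_div₀, hvg, div_one, Valuation.map_sub_swap, ← hϖρ] at h
      exact hR3 g g.2.1 g' g'.2.1 h
    · intro q
      induction q using QuotientGroup.induction_on with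
      | H u =>
        obtain ⟨⟨hσu, hvu⟩, hu1⟩ := (hU₁ u).1 u.2
        obtain ⟨g, hgR, hfg⟩ := hR2 (-((u : Kˣ) : K)) (by rw [map_neg, hσu]) (by rw [Valuation.map_neg, hvu])
        have hbad : Valued.v (1 + g) < 1 := by
          have e : 1 + g = (1 - ((u : Kˣ) : K)) + -(-((u : Kˣ) : K) - g) := by ring
          rw [e]
          refine (Valuation.map_add _ _ _).trans_lt (max_lt ?_ ?_)
          · rw [Valuation.map_sub_swap]
            exact hu1.trans_lt (by rw [← exp_zero, exp_lt_exp]; norm_num)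
          · rw [Valuation.map_neg]; exact hfg.trans_lt hϖρ1
        refine ⟨⟨g, hgR, hbad⟩, ?_⟩
        change (QuotientGroup.mk (toU₁ ⟨g, hgR, hbad⟩) : U₁ ⧸ Uρ.subgroupOf U₁) = QuotientGroup.mk u
        rw [QuotientGroup.eq, Subgroup.mem_subgroupOf, hUρ]
        have hmem : (((toU₁ ⟨g, hgR, hbad⟩)⁻¹ * u : U₁) : Kˣ) ∈ U₁ := Subtype.mem _
        rw [hU₁] at hmem
        refine ⟨hmem.1, ?_⟩
        have hvg : Valued.v g = 1 := (hR1 g hgR).2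
        have hg0 : g ≠ 0 := fun h0 => by rw [h0, map_zero] at hvg; exact zero_ne_one hvg
        have e : (-g)⁻¹ * ((u : Kˣ) : K) - 1 = (-((u : Kˣ) : K) - g) / g := by field_simp
        rw [hcoe]
        change Valued.v ((-g)⁻¹ * ((u : Kˣ) : K) - 1) ≤ exp (-(ρ : ℤ))
        rw [e, map_div₀, hvg, div_one, ← hϖρ]
        exact hfg
  -- count
  have hfinbad : Rbad.Finite := hRfin.subset (Set.sep_subset _ _)
  haveI : Finite Rbad := hfinbad.to_subtype
  rw [← Nat.card_coe_set_eq, Nat.card_congr (Equiv.ofBijective ψ hψ), ← Subgroup.index_eq_card]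
  exact hB

/-- **THE ADMISSIBLE REPRESENTATIVES NUMBER `(q − 2)·q^{⌈ρ∕2⌉−1}`** (same hypotheses): `#{g ∈ R : |1 + g| = 1} = #R − #{g ∈ R : |1 + g| < 1} = (q−1)q^{⌈ρ∕2⌉−1} − q^{⌈ρ∕2⌉−1}`
— the number of `F`-rational classes of the core-hanging invariant `κ` modulo `𝔭^ρ` with `κ ≢ −1 (𝔭)` (MEMO v2 §4 (H): the factor `(q − 2)`).
[cite: Serre1979, Ch. IV §2 Prop. 6] [cite: Kottwitz1986BaseChangeUnits, §1 pp. 240–241] -/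
theorem ncard_admissible_representatives_eq {σ : K →+* K} {ϖ : K} {d : ℕ} (hσ : ∀ x, σ (σ x) = x) (hvσ : ∀ a, Valued.v (σ a) = Valued.v a)
    (hfix : ∀ x : K, σ x = x → x ≠ 0 → ∃ n : ℤ, Valued.v x = exp (2 * n)) (hϖ : Valued.v ϖ = exp (-1 : ℤ))
    (hd : Valued.v (ϖ - σ ϖ) = Valued.v ϖ ^ d) [Finite 𝓀[K]] {ρ : ℕ} (hρ : 1 ≤ ρ) {R : Set K} (hRfin : R.Finite)
    (hRcard : R.ncard = (Nat.card 𝓀[K] - 1) * Nat.card 𝓀[K] ^ ((ρ + 1) / 2 - 1))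
    (hR1 : ∀ g ∈ R, σ g = g ∧ Valued.v g = 1) (hR2 : ∀ f : K, σ f = f → Valued.v f = 1 → ∃ g ∈ R, Valued.v (f - g) ≤ Valued.v ϖ ^ ρ)
    (hR3 : ∀ g ∈ R, ∀ g' ∈ R, Valued.v (g - g') ≤ Valued.v ϖ ^ ρ → g = g') :
    {g ∈ R | Valued.v (1 + g) = 1}.ncard = (Nat.card 𝓀[K] - 2) * Nat.card 𝓀[K] ^ ((ρ + 1) / 2 - 1) := by
  classical
  have hbad := ncard_bad_representatives_eq hσ hvσ hfix hϖ hd hρ hRfin hR1 hR2 hR3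
  -- `{|1+g| = 1} = R \ {|1+g| < 1}`
  have hsplit : {g ∈ R | Valued.v (1 + g) = 1} = R \ {g ∈ R | Valued.v (1 + g) < 1} := by
    ext g
    simp only [Set.mem_setOf_eq, Set.mem_sdiff, not_and, not_lt]
    constructor
    · rintro ⟨hgR, hg⟩; exact ⟨hgR, fun _ => hg.ge⟩
    · rintro ⟨hgR, hg⟩; exact ⟨hgR, le_antisymm (v_one_add_le_one (hR1 g hgR).2) (hg hgR)⟩
  rw [hsplit, Set.ncard_sdiff (Set.sep_subset _ _) (hRfin.subset (Set.sep_subset _ _)), hRcard, hbad]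
  have hq : 1 < Nat.card 𝓀[K] := Finite.one_lt_card
  have e : Nat.card 𝓀[K] - 1 = (Nat.card 𝓀[K] - 2) + 1 := by omega
  rw [e, add_one_mul, Nat.add_sub_cancel]

end Summit.HodgeConjecture.HodgeConjecture.Cruxes.H413.F0P3cDyRamDiagonalCoreHangingClasses

end
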